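import Mathlib.RingTheory.Etale.Pi
import Mathlib.RingTheory.Etale.StandardEtale
import Mathlib.RingTheory.Etale.Field
import Mathlib.RingTheory.Smooth.Flat
import Mathlib.RingTheory.Spectrum.Prime.Chevalley
import Mathlib.RingTheory.Flat.FaithfullyFlat.Algebra
import Mathlib.RingTheory.Localization.AtPrime.Basic
import Mathlib.RingTheory.Artinian.Ring
import Mathlib.FieldTheory.IsSepClosed
import Mathlib.Algebra.Polynomial.Lifts
import HarnessLib

/-!
# Local rings at maximal ideals of a ring in which étale covers split

Stacks 097X (`lemma-have-sections-strictly-henselian`): *if every faithfully flat étale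
`C`-algebra has a retraction, then the local rings of `C` at maximal ideals are strictly
henselian.* This is how the w-strictly local covers entering the proof of Bhatt–Scholze
Theorem 2.3.4 acquire strictly henselian local rings (Bhatt–Scholze Lemma 2.2.9). We prove the
two consequences of this used downstream (in the proof of Olivier's theorem), in a form that
avoids the theory of (strict) henselization absent from Mathlib:

* `exists_algHom_localization_of_retraction` — **points**: an étale `C`-algebra `E` having a
  prime above the maximal ideal `m` admits a `C`-algebra map `E → C_m` (Stacks' argument: the
  image of `Spec E` is open and contains `m`, so `E × C[1/g]` is a faithfully flat étale cover
  for some `g ∈ m`; a retraction `σ` of it yields the idempotent `e₀ = σ(1,0) ∉ m` and the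
  corner `x ↦ σ(x,0)` composed with `C → C_m` is the map);
* `exists_algHom_localization_comap_eq` — the same with a **prescribed** prime `𝔭` above `m`
  (`φ⁻¹(m C_m) = 𝔭`; isolate `𝔭` among the finitely many primes above `m` by inverting one
  element);
* `isSepClosed_quotient_of_retraction` — **the residue field `C/m` is separably closed**
  (apply the first statement to the standard étale algebra `(C[x]/f)[1/f']` of a monic lift `f`
  of a separable irreducible polynomial).

Also: `Algebra.Etale.prod` (binary products of étale algebras are étale; Mathlib only has the
`Π`-version), `IsSepClosed.of_ringEquiv`.

## References

* The Stacks Project, Tags 097X (sections ⇒ strictly henselian local rings), 04GG.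
  [StacksProject]
* B. Bhatt, P. Scholze, *The pro-étale topology for schemes*, Astérisque 369 (2015):
  Def. 2.2.1, Lemma 2.2.9. [BhattScholze2015]

## Design notes

* Theorems only, plus the auxiliary `boolFam`/`piBoolAlgEquiv` (D-0026). Universe `u` throughout
  (the retraction hypothesis quantifies over `Type u`).
* Mathlib searched/used: `PrimeSpectrum.isOpenMap_comap_of_hasGoingDown_of_finitePresentation`
  (Chevalley + going down), `Algebra.HasGoingDown.of_flat`, `StandardEtalePair` (`Ring`, `lift`,
  `hasMap_X`), `Algebra.FormallyUnramified.finite_of_free`, `IsArtinianRing`,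
  `IsSepClosed.of_exists_root`, `Polynomial.lifts_and_degree_eq_and_monic`,
  `Polynomial.Separable.aeval_derivative_ne_zero`, `IsLocalization.AtPrime`. Nothing restated.
-/

universe u

open Polynomial

namespace Literature.RingTheory.Etale

noncomputable section

/-! ### Binary products of étale algebras -/

section Prod

variable (R : Type u) [CommRing R] (E F : Type u) [CommRing E] [CommRing F] [Algebra R E]
  [Algebra R F]

/-- The `Bool`-indexed family `(E, F)`. [folklore] -/
def boolFam : Bool → Type u := fun b => cond b E F

/-- The ring structures on the `Bool`-indexed family `(E, F)`. [folklore] -/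
instance boolFam_commRing (b : Bool) : CommRing (boolFam E F b) :=
  match b with
  | true => inferInstanceAs (CommRing E)
  | false => inferInstanceAs (CommRing F)

/-- The `R`-algebra structures on the `Bool`-indexed family `(E, F)`. [folklore] -/
instance boolFam_algebra (b : Bool) : Algebra R (boolFam E F b) :=
  match b with
  | true => inferInstanceAs (Algebra R E)
  | false => inferInstanceAs (Algebra R F)

/-- Both members of the `Bool`-indexed family `(E, F)` are étale when `E` and `F` are. [folklore] -/
instance boolFam_etale [Algebra.Etale R E] [Algebra.Etale R F] (b : Bool) :
    Algebra.Etale R (boolFam E F b) :=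
  match b with
  | true => inferInstanceAs (Algebra.Etale R E)
  | false => inferInstanceAs (Algebra.Etale R F)

/-- `Π b, (E,F)_b ≃ E × F`. [folklore] -/
def piBoolAlgEquiv : (Π b, boolFam E F b) ≃ₐ[R] E × F where
  toFun f := (f true, f false)
  invFun p := fun b => match b with
    | true => p.1
    | false => p.2
  left_inv f := by
    funext b
    cases b <;> rfl
  right_inv _ := rfl
  map_mul' _ _ := rfl
  map_add' _ _ := rfl
  commutes' _ := rfl

/-- **Binary products of étale algebras are étale.** [folklore] -/
theorem etale_prod [Algebra.Etale R E] [Algebra.Etale R F] : Algebra.Etale R (E × F) :=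
  Algebra.Etale.of_equiv (piBoolAlgEquiv R E F)

end Prod

/-! ### Points of étale algebras in the local rings at maximal ideals -/

section Points

variable {C : Type u} [CommRing C]
  (hret : ∀ (B : Type u) [CommRing B] [Algebra C B] [Algebra.Etale C B]
    [Module.FaithfullyFlat C B], Nonempty (B →ₐ[C] C))
  (m : Ideal C) [m.IsMaximal]

include hret

/-- **Stacks 097X, points.** If every faithfully flat étale `C`-algebra has a retraction, then an
étale `C`-algebra `E` with a prime above the maximal ideal `m` admits a `C`-algebra map
`E → C_m`. [cite: StacksProject, Tag 097X] -/
theorem exists_algHom_localization_of_retraction (E : Type u) [CommRing E] [Algebra C E]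
    [Algebra.Etale C E] (hE : ∃ P : Ideal E, P.IsPrime ∧ P.comap (algebraMap C E) = m) :
    Nonempty (E →ₐ[C] Localization.AtPrime m) := by
  classical
  obtain ⟨P, hP, hPm⟩ := hE
  haveI : Module.Flat C E := Algebra.Smooth.flat C E
  -- the image of `Spec E → Spec C` is open; its complement is `V(𝔟)` with `𝔟 ⊄ m`
  let U : Set (PrimeSpectrum C) := Set.range (PrimeSpectrum.comap (algebraMap C E))
  have hU : IsOpen U :=
    (PrimeSpectrum.isOpenMap_comap_of_hasGoingDown_of_finitePresentation).isOpen_range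
  obtain ⟨𝔟, h𝔟⟩ := (PrimeSpectrum.isClosed_iff_zeroLocus_ideal _).1 hU.isClosed_compl
  have hmU : (⟨m, Ideal.IsMaximal.isPrime inferInstance⟩ : PrimeSpectrum C) ∈ U :=
    ⟨⟨P, hP⟩, PrimeSpectrum.ext hPm⟩
  have h𝔟m : ¬ 𝔟 ≤ m := by
    intro hle
    have : (⟨m, Ideal.IsMaximal.isPrime inferInstance⟩ : PrimeSpectrum C) ∈ Uᶜ := by
      rw [h𝔟]; exact hle
    exact this hmU
  -- `b + g = 1` with `b ∈ 𝔟`, `g ∈ m`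
  have hsup : 𝔟 ⊔ m = ⊤ := by
    by_contra h
    have heq := Ideal.IsMaximal.eq_of_le ‹m.IsMaximal› h le_sup_right
    exact h𝔟m (le_sup_left.trans heq.symm.le)
  obtain ⟨b, hb, g, hg, hbg⟩ := Submodule.mem_sup.1 ((Ideal.eq_top_iff_one _).1 hsup)
  -- every prime is in `U` or avoids `g`
  have hcover : ∀ 𝔫 : PrimeSpectrum C, 𝔫 ∈ U ∨ g ∉ 𝔫.asIdeal := by
    intro 𝔫
    by_cases h𝔫 : 𝔫 ∈ U
    · exact Or.inl h𝔫
    · right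
      intro hg𝔫
      have hb𝔫 : b ∈ 𝔫.asIdeal := by
        have : 𝔫 ∈ Uᶜ := h𝔫
        rw [h𝔟] at this
        exact this hb
      have : (1 : C) ∈ 𝔫.asIdeal := hbg ▸ 𝔫.asIdeal.add_mem hb𝔫 hg𝔫
      exact 𝔫.2.ne_top ((Ideal.eq_top_iff_one _).2 this)
  -- the faithfully flat étale cover `B = E × C[1/g]`
  let L := Localization.Away g
  let B := E × L
  haveI : Algebra.Etale C B := etale_prod C E L
  haveI : Module.FaithfullyFlat C B := by
    rw [Module.FaithfullyFlat.iff_flat_and_proper_ideal]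
    refine ⟨Algebra.Smooth.flat C B, fun J hJ htop => ?_⟩
    obtain ⟨𝔫, h𝔫, hJ𝔫⟩ := Ideal.exists_le_maximal J hJ
    have htop' : 𝔫.map (algebraMap C B) = ⊤ := by
      have h1 : J • (⊤ : Submodule C B) ≤ 𝔫 • ⊤ := Submodule.smul_mono_left hJ𝔫
      rw [htop, top_le_iff, Ideal.smul_top_eq_map] at h1
      exact (Submodule.restrictScalars_eq_top_iff _ _ _).1 h1
    rcases hcover ⟨𝔫, h𝔫.isPrime⟩ with ⟨⟨Q, hQ⟩⟩ | hg𝔫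
    · -- `𝔫 = Q ∩ C`: project to `E`
      have hQ𝔫 : Q.asIdeal.comap (algebraMap C E) = 𝔫 := congrArg PrimeSpectrum.asIdeal hQ
      have h1 : 𝔫.map (algebraMap C E) = ⊤ := by
        have := congrArg (fun I : Ideal B => I.map (RingHom.fst E L)) htop'
        simp only [Ideal.map_top] at this
        rwa [Ideal.map_map, show (RingHom.fst E L).comp (algebraMap C B) = algebraMap C E from rfl]
          at this
      have h2 : 𝔫.map (algebraMap C E) ≤ Q.asIdeal := Ideal.map_le_iff_le_comap.2 hQ𝔫.ge
      rw [h1, top_le_iff] at h2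
      exact Q.2.ne_top h2
    · -- `g ∉ 𝔫`: project to `C[1/g]`
      have h1 : 𝔫.map (algebraMap C L) = ⊤ := by
        have := congrArg (fun I : Ideal B => I.map (RingHom.snd E L)) htop'
        simp only [Ideal.map_top] at this
        rwa [Ideal.map_map, show (RingHom.snd E L).comp (algebraMap C B) = algebraMap C L from rfl]
          at this
      have hdisj : Disjoint (Submonoid.powers g : Set C) (𝔫 : Set C) := by
        rw [Set.disjoint_left]
        rintro _ ⟨k, rfl⟩ hk
        exact hg𝔫 (h𝔫.isPrime.mem_of_pow_mem k hk)
      haveI : (𝔫.map (algebraMap C L)).IsPrime :=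
        IsLocalization.isPrime_of_isPrime_disjoint (Submonoid.powers g) L 𝔫 h𝔫.isPrime hdisj
      exact Ideal.IsPrime.ne_top' (I := 𝔫.map (algebraMap C L)) h1
  -- a retraction, and the idempotent `e₀ = σ(1,0)`
  obtain ⟨σ⟩ := hret B
  let e₀ : C := σ ((1 : E), (0 : L))
  have he₀ : IsIdempotentElem e₀ := by
    change σ _ * σ _ = σ _
    rw [← map_mul, Prod.mk_mul_mk, mul_one, mul_zero]
  have hsmul : ∀ (c : C) (x : E) (y : L), σ (c • x, c • y) = c * σ (x, y) := by
    intro c x y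
    rw [← smul_eq_mul, ← map_smul, Prod.smul_mk]
  -- `e₀ ∉ m`: otherwise the other corner would make `g` a unit in `C/m`
  have he₀m : e₀ ∉ m := by
    intro he₀m
    haveI : Nontrivial (C ⧸ m) := Ideal.Quotient.nontrivial_iff.2 (Ideal.IsMaximal.ne_top ‹_›)
    let ρ : L →+* C ⧸ m :=
      { toFun := fun y => Ideal.Quotient.mk m (σ ((0 : E), y))
        map_one' := by
          have h1 : σ ((0 : E), (1 : L)) = 1 - e₀ := by
            rw [eq_sub_iff_add_eq, ← map_add, Prod.mk_add_mk, zero_add, add_zero]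
            exact map_one σ
          change Ideal.Quotient.mk m (σ ((0 : E), (1 : L))) = 1
          rw [h1, map_sub, map_one, Ideal.Quotient.eq_zero_iff_mem.2 he₀m, sub_zero]
        map_mul' := fun x y => by
          change Ideal.Quotient.mk m (σ ((0 : E), x * y)) = Ideal.Quotient.mk m _ * Ideal.Quotient.mk m _
          rw [← map_mul, ← map_mul, Prod.mk_mul_mk, mul_zero]
        map_zero' := by
          change Ideal.Quotient.mk m (σ ((0 : E), (0 : L))) = 0
          rw [show ((0 : E), (0 : L)) = (0 : B) from rfl, map_zero, map_zero]
        map_add' := fun x y => by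
          change Ideal.Quotient.mk m (σ ((0 : E), x + y)) = Ideal.Quotient.mk m _ + Ideal.Quotient.mk m _
          rw [← map_add, ← map_add, Prod.mk_add_mk, add_zero] }
    have hunit : IsUnit (ρ (algebraMap C L g)) := (IsLocalization.Away.algebraMap_isUnit g).map ρ
    have hzero : ρ (algebraMap C L g) = 0 := by
      change Ideal.Quotient.mk m (σ ((0 : E), algebraMap C L g)) = 0
      have : ((0 : E), algebraMap C L g) = (g • (0 : E), g • (1 : L)) := by
        rw [smul_zero, Algebra.algebraMap_eq_smul_one]
      rw [this, hsmul, map_mul, Ideal.Quotient.eq_zero_iff_mem.2 hg, zero_mul]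
    rw [hzero] at hunit
    exact not_isUnit_zero hunit
  -- the corner map `x ↦ σ(x,0)`, composed with `C → C_m`, is a `C`-algebra map
  have hunit₀ : IsUnit (algebraMap C (Localization.AtPrime m) e₀) :=
    IsLocalization.map_units _ (⟨e₀, he₀m⟩ : m.primeCompl)
  have hone : algebraMap C (Localization.AtPrime m) e₀ = 1 := by
    obtain ⟨v, hv⟩ := hunit₀
    have hidem : algebraMap C (Localization.AtPrime m) e₀ * algebraMap C _ e₀ = algebraMap C _ e₀ := by
      rw [← map_mul]; exact congrArg _ he₀
    rw [← hv] at hidem ⊢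
    have := congrArg (fun z => (↑v⁻¹ : Localization.AtPrime m) * z) hidem
    simpa [← mul_assoc] using this
  refine ⟨{ toFun := fun x => algebraMap C (Localization.AtPrime m) (σ (x, (0 : L)))
            map_one' := hone
            map_mul' := fun x y => by
              change algebraMap C _ (σ (x * y, (0 : L))) = _
              rw [← map_mul, ← map_mul, Prod.mk_mul_mk, mul_zero]
            map_zero' := by
              change algebraMap C _ (σ ((0 : E), (0 : L))) = 0
              rw [show ((0 : E), (0 : L)) = (0 : B) from rfl, map_zero, map_zero]
            map_add' := fun x y => by
              change algebraMap C _ (σ (x + y, (0 : L))) = _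
              rw [← map_add, ← map_add, Prod.mk_add_mk, add_zero]
            commutes' := fun c => by
              have : (algebraMap C E c, (0 : L)) = (c • (1 : E), c • (0 : L)) := by
                rw [smul_zero, Algebra.algebraMap_eq_smul_one]
              rw [this, hsmul, map_mul, hone, mul_one] }⟩

omit hret in
/-- The primes of an étale algebra above a maximal ideal are finite in number. [folklore] -/
theorem finite_primesOver_of_etale (E : Type u) [CommRing E] [Algebra C E] [Algebra.Etale C E] :
    {P : Ideal E | P.IsPrime ∧ P.comap (algebraMap C E) = m}.Finite := by
  classical
  -- primes above `m` are the primes containing `m E`, i.e. the primes of `E / m E`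
  let E' := E ⧸ m.map (algebraMap C E)
  letI : Field (C ⧸ m) := Ideal.Quotient.field m
  haveI : Algebra.FormallyUnramified C E' :=
    Algebra.FormallyUnramified.of_surjective (Ideal.Quotient.mkₐ C _) Ideal.Quotient.mk_surjective
  haveI : Algebra.FormallyUnramified (C ⧸ m) E' :=
    Algebra.FormallyUnramified.of_restrictScalars (R := C) (C ⧸ m) E'
  haveI : Algebra.FiniteType (C ⧸ m) E' :=
    Algebra.FiniteType.of_restrictScalars_finiteType C (C ⧸ m) E'
  haveI : Module.Finite (C ⧸ m) E' := Algebra.FormallyUnramified.finite_of_free (C ⧸ m) E'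
  haveI : IsArtinianRing E' := IsArtinianRing.of_finite (C ⧸ m) E'
  have hfin : (Set.univ : Set (PrimeSpectrum E')).Finite := Set.finite_univ
  -- the injection `P ↦ P / mE`
  refine (hfin.image fun Q : PrimeSpectrum E' => Q.asIdeal.comap (Ideal.Quotient.mk _)).subset ?_
  rintro P ⟨hP, hPm⟩
  have hle : m.map (algebraMap C E) ≤ P := Ideal.map_le_iff_le_comap.2 hPm.ge
  haveI : (P.map (Ideal.Quotient.mk (m.map (algebraMap C E)))).IsPrime :=
    Ideal.map_isPrime_of_surjective Ideal.Quotient.mk_surjective (by rwa [Ideal.mk_ker])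
  refine ⟨⟨P.map (Ideal.Quotient.mk _), inferInstance⟩, Set.mem_univ _, ?_⟩
  change (P.map (Ideal.Quotient.mk _)).comap (Ideal.Quotient.mk _) = P
  rw [Ideal.comap_map_of_surjective _ Ideal.Quotient.mk_surjective, ← RingHom.ker_eq_comap_bot,
    Ideal.mk_ker, sup_eq_left]
  exact hle

omit hret in
/-- Primes of an étale algebra above the same maximal ideal are incomparable. [folklore] -/
theorem eq_of_le_of_primesOver_of_etale (E : Type u) [CommRing E] [Algebra C E] [Algebra.Etale C E]
    {P Q : Ideal E} [P.IsPrime] [Q.IsPrime] (hP : P.comap (algebraMap C E) = m)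
    (hQ : Q.comap (algebraMap C E) = m) (hle : P ≤ Q) : P = Q := by
  classical
  let E' := E ⧸ m.map (algebraMap C E)
  letI : Field (C ⧸ m) := Ideal.Quotient.field m
  haveI : Algebra.FormallyUnramified C E' :=
    Algebra.FormallyUnramified.of_surjective (Ideal.Quotient.mkₐ C _) Ideal.Quotient.mk_surjective
  haveI : Algebra.FormallyUnramified (C ⧸ m) E' :=
    Algebra.FormallyUnramified.of_restrictScalars (R := C) (C ⧸ m) E'
  haveI : Algebra.FiniteType (C ⧸ m) E' :=
    Algebra.FiniteType.of_restrictScalars_finiteType C (C ⧸ m) E'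
  haveI : Module.Finite (C ⧸ m) E' := Algebra.FormallyUnramified.finite_of_free (C ⧸ m) E'
  haveI : IsArtinianRing E' := IsArtinianRing.of_finite (C ⧸ m) E'
  have hmP : m.map (algebraMap C E) ≤ P := Ideal.map_le_iff_le_comap.2 hP.ge
  have hmQ : m.map (algebraMap C E) ≤ Q := Ideal.map_le_iff_le_comap.2 hQ.ge
  have hkP : RingHom.ker (Ideal.Quotient.mk (m.map (algebraMap C E))) ≤ P := by rwa [Ideal.mk_ker]
  have hkQ : RingHom.ker (Ideal.Quotient.mk (m.map (algebraMap C E))) ≤ Q := by rwa [Ideal.mk_ker]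
  haveI hP' : (P.map (Ideal.Quotient.mk (m.map (algebraMap C E)))).IsPrime :=
    Ideal.map_isPrime_of_surjective Ideal.Quotient.mk_surjective hkP
  haveI hQ' : (Q.map (Ideal.Quotient.mk (m.map (algebraMap C E)))).IsPrime :=
    Ideal.map_isPrime_of_surjective Ideal.Quotient.mk_surjective hkQ
  have hmax : (P.map (Ideal.Quotient.mk (m.map (algebraMap C E)))).IsMaximal :=
    IsArtinianRing.isMaximal_of_isPrime _
  have heq := hmax.eq_of_le hQ'.ne_top (Ideal.map_mono hle)
  have := congrArg (fun I => I.comap (Ideal.Quotient.mk (m.map (algebraMap C E)))) heq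
  rwa [Ideal.comap_map_of_surjective _ Ideal.Quotient.mk_surjective,
    Ideal.comap_map_of_surjective _ Ideal.Quotient.mk_surjective, ← RingHom.ker_eq_comap_bot,
    Ideal.mk_ker, sup_eq_left.2 hmP, sup_eq_left.2 hmQ] at this

/-- **Stacks 097X, points with prescribed centre.** Under the retraction hypothesis, for an étale
`C`-algebra `E` and a prime `𝔭 ⊆ E` above the maximal ideal `m` there is a `C`-algebra map
`φ : E → C_m` with `φ⁻¹(m C_m) = 𝔭` (invert an element lying in all the other primes above `m`
but not in `𝔭`, and apply `exists_algHom_localization_of_retraction`).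
[cite: StacksProject, Tag 097X] -/
theorem exists_algHom_localization_comap_eq (E : Type u) [CommRing E] [Algebra C E]
    [Algebra.Etale C E] (𝔭 : Ideal E) [𝔭.IsPrime] (h𝔭 : 𝔭.comap (algebraMap C E) = m) :
    ∃ φ : E →ₐ[C] Localization.AtPrime m,
      (IsLocalRing.maximalIdeal (Localization.AtPrime m)).comap φ.toRingHom = 𝔭 := by
  classical
  -- an element in all other primes above `m` but not in `𝔭`
  let others : Finset (Ideal E) :=
    ((finite_primesOver_of_etale m E).toFinset).erase 𝔭
  have hothers : ∀ Q ∈ others, Q.IsPrime ∧ Q.comap (algebraMap C E) = m ∧ Q ≠ 𝔭 := by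
    intro Q hQ
    obtain ⟨hne, hQ⟩ := Finset.mem_erase.1 hQ
    exact ⟨((Set.Finite.mem_toFinset _).1 hQ).1, ((Set.Finite.mem_toFinset _).1 hQ).2, hne⟩
  have hnot : ¬ others.inf id ≤ 𝔭 := by
    intro hle
    obtain ⟨Q, hQ, hQ𝔭⟩ := (Ideal.IsPrime.inf_le' inferInstance).1 hle
    obtain ⟨hQp, hQm, hne⟩ := hothers Q hQ
    haveI := hQp
    exact hne (eq_of_le_of_primesOver_of_etale m E hQm h𝔭 hQ𝔭)
  obtain ⟨t, ht, ht𝔭⟩ := Set.not_subset.1 hnot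
  -- localize away from `t`
  let Et := Localization.Away t
  have hdisj : Disjoint (Submonoid.powers t : Set E) (𝔭 : Set E) := by
    rw [Set.disjoint_left]
    rintro _ ⟨k, rfl⟩ hk
    exact ht𝔭 (Ideal.IsPrime.mem_of_pow_mem inferInstance k hk)
  haveI h𝔭t : (𝔭.map (algebraMap E Et)).IsPrime :=
    IsLocalization.isPrime_of_isPrime_disjoint (Submonoid.powers t) Et 𝔭 inferInstance hdisj
  have hcomap𝔭 : (𝔭.map (algebraMap E Et)).comap (algebraMap E Et) = 𝔭 :=
    IsLocalization.under_map_of_isPrime_disjoint (Submonoid.powers t) Et inferInstance hdisj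
  obtain ⟨φt⟩ := exists_algHom_localization_of_retraction hret m Et
    ⟨𝔭.map (algebraMap E Et), h𝔭t, by
      rw [IsScalarTower.algebraMap_eq C E Et, ← Ideal.comap_comap, hcomap𝔭, h𝔭]⟩
  let φ : E →ₐ[C] Localization.AtPrime m := φt.comp (IsScalarTower.toAlgHom C E Et)
  refine ⟨φ, ?_⟩
  -- `φ⁻¹(m C_m)` is a prime above `m` not containing `t`, hence `𝔭`
  let Q : Ideal E := (IsLocalRing.maximalIdeal (Localization.AtPrime m)).comap φ.toRingHom
  haveI hQ : Q.IsPrime := Ideal.comap_isPrime _ _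
  have hQm : Q.comap (algebraMap C E) = m := by
    change ((IsLocalRing.maximalIdeal _).comap φ.toRingHom).comap (algebraMap C E) = m
    rw [Ideal.comap_comap, show φ.toRingHom.comp (algebraMap C E) = algebraMap C _ from
      φ.comp_algebraMap]
    exact IsLocalization.AtPrime.under_maximalIdeal _ m
  have htQ : t ∉ Q := by
    intro htQ
    have hu : IsUnit (φ t) := by
      change IsUnit (φt (algebraMap E Et t))
      exact (IsLocalization.Away.algebraMap_isUnit t).map φt
    exact (IsLocalRing.mem_maximalIdeal _).1 htQ hu
  by_contra hne
  have hmem : Q ∈ others := by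
    refine Finset.mem_erase.2 ⟨hne, (Set.Finite.mem_toFinset _).2 ⟨hQ, hQm⟩⟩
  exact htQ (Finset.inf_le (f := id) hmem ht)

/-! ### The residue fields are separably closed -/

omit hret in
/-- Separable closedness transfers along ring isomorphisms. [folklore] -/
theorem IsSepClosed.of_ringEquiv {k k' : Type*} [Field k] [Field k'] (e : k ≃+* k') [IsSepClosed k] :
    IsSepClosed k' := by
  refine IsSepClosed.of_exists_root k' fun p hp hirr hsep => ?_
  let q : k[X] := p.map (e.symm : k' →+* k)
  have hq : q.map (e : k →+* k') = p := by
    rw [Polynomial.map_map]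
    have : (e : k →+* k').comp (e.symm : k' →+* k) = RingHom.id k' := by
      ext x; simp
    rw [this, Polynomial.map_id]
  have hqdeg : q.degree ≠ 0 := by
    rw [Polynomial.degree_map]
    exact (Polynomial.degree_pos_of_irreducible hirr).ne'
  have hqsep : q.Separable := hsep.map
  obtain ⟨x, hx⟩ := IsSepClosed.exists_root q hqdeg hqsep
  refine ⟨e x, ?_⟩
  have : p.eval (e x) = e (q.eval x) := by
    rw [← hq, Polynomial.eval_map]
    exact Polynomial.eval₂_hom (e : k →+* k') x
  rw [this, show q.eval x = 0 from hx, map_zero]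

/-- **Stacks 097X, residue fields.** Under the retraction hypothesis the residue field `C/m` at a
maximal ideal is separably closed: a monic irreducible separable `p̄ ∈ (C/m)[x]` lifts to a
monic `f`; the standard étale algebra `(C[x]/f)[1/f']` has a prime above `m` (map it to the
field `(C/m)[x]/(p̄)`), hence a `C`-point in `C_m`, whose reduction is a root of `p̄`.
[cite: StacksProject, Tag 097X] -/
theorem isSepClosed_quotient_of_retraction :
    letI : Field (C ⧸ m) := Ideal.Quotient.field m
    IsSepClosed (C ⧸ m) := by
  classical
  letI : Field (C ⧸ m) := Ideal.Quotient.field m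
  refine IsSepClosed.of_exists_root _ fun p hp hirr hsep => ?_
  -- lift `p` to a monic `f ∈ C[x]`
  have hlift : p ∈ Polynomial.lifts (Ideal.Quotient.mk m) := by
    obtain ⟨q, hq⟩ := Polynomial.map_surjective (Ideal.Quotient.mk m) Ideal.Quotient.mk_surjective p
    exact ⟨q, hq⟩
  obtain ⟨f, hfp, -, hfmonic⟩ := Polynomial.lifts_and_degree_eq_and_monic hlift hp
  -- the standard étale algebra `(C[x]/f)[1/f']`
  let SP : StandardEtalePair C :=
    { f := f
      monic_f := hfmonic
      g := derivative f
      cond := ⟨1, 0, 1, by ring⟩ }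
  let E := SP.Ring
  -- a point of `E` in the field `K' = (C/m)[x]/(p)`, giving a prime of `E` above `m`
  haveI : Fact (Irreducible p) := ⟨hirr⟩
  let K' := AdjoinRoot p
  have hroot : aeval (AdjoinRoot.root p) f = 0 := by
    rw [← Polynomial.aeval_map_algebraMap (C ⧸ m), show f.map (algebraMap C (C ⧸ m)) = p from hfp]
    exact AdjoinRoot.eval₂_root p
  have hder : IsUnit (aeval (AdjoinRoot.root p) (derivative f)) := by
    rw [← Polynomial.aeval_map_algebraMap (C ⧸ m), ← Polynomial.derivative_map,
      show f.map (algebraMap C (C ⧸ m)) = p from hfp]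
    exact (hsep.aeval_derivative_ne_zero (AdjoinRoot.eval₂_root p)).isUnit
  let ψ : E →ₐ[C] K' := SP.lift (AdjoinRoot.root p) ⟨hroot, hder⟩
  have hE : ∃ P : Ideal E, P.IsPrime ∧ P.comap (algebraMap C E) = m := by
    refine ⟨RingHom.ker ψ.toRingHom, RingHom.ker_isPrime _, ?_⟩
    rw [RingHom.comap_ker, ψ.toRingHom_eq_coe, ψ.comp_algebraMap,
      IsScalarTower.algebraMap_eq C (C ⧸ m) K', ← RingHom.comap_ker,
      (RingHom.injective_iff_ker_eq_bot _).1 (algebraMap (C ⧸ m) K').injective,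
      ← RingHom.ker_eq_comap_bot, Ideal.Quotient.algebraMap_eq, Ideal.mk_ker]
  -- a point in `C_m`, and its reduction
  obtain ⟨φ⟩ := exists_algHom_localization_of_retraction hret m E hE
  let α : Localization.AtPrime m := φ SP.X
  have hα : aeval α f = 0 := by
    change aeval (φ SP.X) f = 0
    rw [Polynomial.aeval_algHom_apply, SP.hasMap_X.1, map_zero]
  -- the reduction map `C_m → C/m`
  let r : Localization.AtPrime m →+* C ⧸ m :=
    IsLocalization.lift (M := m.primeCompl) (g := Ideal.Quotient.mk m) fun s =>
      isUnit_iff_ne_zero.2 fun h => s.2 (Ideal.Quotient.eq_zero_iff_mem.1 h)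
  have hr : ∀ c : C, r (algebraMap C _ c) = Ideal.Quotient.mk m c := fun c =>
    IsLocalization.lift_eq _ c
  refine ⟨r α, ?_⟩
  have : p.eval (r α) = r (aeval α f) := by
    rw [← hfp, Polynomial.eval_map, Polynomial.aeval_def, Polynomial.hom_eval₂]
    congr 1
    ext c
    exact (hr c).symm
  rw [this, hα, map_zero]

end Points


end

end Literature.RingTheory.Etale
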